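import Summits.CriticalPhenomena.PercolationContinuityZ3.Theorems.Transplant.BoxProdZ2ConcParamsAtQ
import HarnessLib

/-!
# (S) More unpacking at the concrete choices, for the ROOT residue (R) and the inner routes of (F): the root tube radius
# `Rt := F 1 - L'` and what lies inside it, the root's route scales `[M+1, t + R'] ⊆ [M+1, 6t]` and first-hop scale `6t`, the level
# window's lower end `M + 1 ≤ Rlev`, and the planar arithmetic of `t = K · 100 (R'+1)` by name (companion of `BoxProdZ2ConcParamsAtQ`)

builds on p205010 (kernel theorem, internal audit signed; external expert review pending) — nothing in this file uses p205010.
Status sentence (coordinator 2026-08-20T04:30Z): "θ(p_c) = 0 on ℤ^d, all d ≥ 2 — kernel-verified (Lean 4/Mathlib, standard axioms); internal adversarial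
audit SIGNED 2026-08-20 04:29Z; external expert review pending."
Lane `prim-bschramm-*`, seat `prim-bschramm-stmt` (gen 6); helper file (`--supports stmt-CriticalPhenomena-4575`).

* arithmetic: `Conc.R'c_eq`, `Conc.tc_eq`, `Conc.lt_R'c`, `Conc.R'c_succ_le_tc` (`2000 (R'+1) ≤ t`), `Conc.tc_add_R'c_le` (`t + R' ≤ 6t`),
  `Conc.root_arith` (`M + 47 R' + 2 ≤ t`, p2-g2's `RootRunOK` numerics), `Conc.hMR` (`M + 1 ≤ M + L`), `Conc.ψ_mid_le` (`ψ (t+R') ≤ ψ (6t)`);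
* the root tube: with `Rt := Frad (gapc …) 0 (E₀c …) 1 - L'c …` (`Conc.hRt`): `Conc.E₀_le_Rt`, `Conc.L'_le_Rt`, `Conc.Rex_le_Rt_sub`
  (`Rexc q (E₀+1) ≤ Rt - L'`), `Conc.ψ_le_Rt`, `Conc.ψ_top_le_Rt`, `Conc.hL_root` (`ψ (t+R') + ψ M ≤ L'`);
* inputs: `Conc.hlink_root_at` (scales `[M+1, t+R']`), `Conc.hlink_top_at` (the first-hop scale `6t`).
[cite: KozmaNitzan2024, §4 Theorem 6 (pp. 25–31), p. 28 ((32) at the root), Lemma 11 (pp. 22–23)]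
-/

noncomputable section

open MeasureTheory
open scoped Classical

namespace Summit.CriticalPhenomena.PercolationContinuityZ3.Theorems

namespace Transplant

namespace BoxProdZ2

open Literature.Probability.Percolation Literature.Probability.LatticeModels SimpleGraph KNCells KNLevels
open Literature.Probability.Percolation.GM (HOct piece)
open Literature.Barriers.CriticalPhenomena (IsQuasiTransitive IsGraphAmenable)

namespace Conc

/-! ## Arithmetic of the planar constants -/

section Consts

variable {κ : ConcConsts} {W : Type} [Countable W] {X : SimpleGraph W} [X.LocallyFinite] {hqt : IsQuasiTransitive X}
  {p : unitInterval} {hT : TubeSubcritical X p} {δA : ℝ} {M : ℕ}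

/-- `R' = M + L + 1`. [folklore] -/
theorem R'c_eq : R'c κ X hqt p hT δA M = M + Lc κ X hqt p hT δA M + 1 := rfl

/-- `t = K · (100 (R' + 1))`. [folklore] -/
theorem tc_eq : tc κ X hqt p hT δA M = Kof κ.K₀ * (100 * (R'c κ X hqt p hT δA M + 1)) := rfl

/-- `M < R'`. [folklore] -/
theorem lt_R'c : M < R'c κ X hqt p hT δA M := by rw [R'c_eq]; omega

/-- `2000 (R' + 1) ≤ t` (`K ≥ 20`). [folklore] -/
theorem R'c_succ_le_tc : 2000 * (R'c κ X hqt p hT δA M + 1) ≤ tc κ X hqt p hT δA M := by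
  have hK := twenty_le_Kof κ.K₀
  rw [tc_eq]
  nlinarith

/-- `t + R' ≤ 6 t` (the root's route scales lie below the top scale `6t`). [folklore] -/
theorem tc_add_R'c_le : tc κ X hqt p hT δA M + R'c κ X hqt p hT δA M ≤ 6 * tc κ X hqt p hT δA M := by
  have h := R'c_succ_le_tc (κ := κ) (X := X) (hqt := hqt) (p := p) (hT := hT) (δA := δA) (M := M)
  omega

/-- **The root schedule's numerics**: `M + 47 R' + 2 ≤ t` (p2-g2's `RootRunOK` with `ca = 26t - m - 1`, `cb = 0`, `q' = 3t`, `m ≤ M`).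
[folklore] -/
theorem root_arith : M + 47 * R'c κ X hqt p hT δA M + 2 ≤ tc κ X hqt p hT δA M := by
  have h := R'c_succ_le_tc (κ := κ) (X := X) (hqt := hqt) (p := p) (hT := hT) (δA := δA) (M := M)
  have h' := lt_R'c (κ := κ) (X := X) (hqt := hqt) (p := p) (hT := hT) (δA := δA) (M := M)
  omega

/-- `R' + (M + 1) ≤ t` and `2 R' ≤ t` packaged: `2 R' + M + 1 ≤ t`. [folklore] -/
theorem two_R'c_le : 2 * R'c κ X hqt p hT δA M + M + 1 ≤ tc κ X hqt p hT δA M := by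
  have h := R'c_succ_le_tc (κ := κ) (X := X) (hqt := hqt) (p := p) (hT := hT) (δA := δA) (M := M)
  have h' := lt_R'c (κ := κ) (X := X) (hqt := hqt) (p := p) (hT := hT) (δA := δA) (M := M)
  omega

/-- `M + 1 ≤ Rlev` for `Rlev := M + L` (`0 < L`). [folklore] -/
theorem hMR (h0 : 0 < δA) (hp0 : 0 < (p : ℝ)) (hp1 : (p : ℝ) < 1) : M + 1 ≤ M + Lc κ X hqt p hT δA M := by
  have := Lc_pos (κ := κ) (X := X) (hqt := hqt) (hT := hT) (M := M) h0 hp0 hp1; omega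

/-- `ψ (t + R') ≤ ψ (6 t)`. [folklore] -/
theorem ψ_mid_le : ψ X hqt p hT (tc κ X hqt p hT δA M + R'c κ X hqt p hT δA M) ≤ ψ X hqt p hT (6 * tc κ X hqt p hT δA M) :=
  ufatRadius_mono X hT _ tc_add_R'c_le

/-- `M ≤ 6 t`. [folklore] -/
theorem le_six_tc : M ≤ 6 * tc κ X hqt p hT δA M := (lt_six_mul_tOf κ.K₀ M _).le

end Consts

/-! ## The root tube `Rt = F 1 - L'` -/

section Root

variable {κ : ConcConsts} {W : Type} [DecidableEq W] [Countable W] {X : SimpleGraph W} [X.LocallyFinite] {hqt : IsQuasiTransitive X}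
  {w : W} {p : unitInterval} {hT : TubeSubcritical X p} {δA : ℝ} {M : ℕ} {q : unitInterval}

/-- `E₀ ≤ Rt`. [folklore] -/
theorem E₀_le_Rt : E₀c κ X hqt w p hT δA M q ≤
    Frad (gapc κ X hqt w p hT δA M q) (fun _ => 0) (E₀c κ X hqt w p hT δA M q) 1 - L'c κ X hqt w p hT δA M q := by
  rw [hRt]; omega

/-- `L' ≤ Rt`. [folklore] -/
theorem L'_le_Rt : L'c κ X hqt w p hT δA M q ≤
    Frad (gapc κ X hqt w p hT δA M q) (fun _ => 0) (E₀c κ X hqt w p hT δA M q) 1 - L'c κ X hqt w p hT δA M q := by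
  rw [hRt]; omega

/-- **The root's rim excess fits**: `Rex q (E₀ + 1) ≤ Rt - L'` (entrances from the wired root cube at fibre radius `≤ E₀ + 1`). [folklore] -/
theorem Rex_le_Rt_sub : Rexc κ X hqt w p hT δA M q (E₀c κ X hqt w p hT δA M q + 1) ≤
    Frad (gapc κ X hqt w p hT δA M q) (fun _ => 0) (E₀c κ X hqt w p hT δA M q) 1 - L'c κ X hqt w p hT δA M q -
      L'c κ X hqt w p hT δA M q := by
  rw [hRt]; omega

/-- `ψ M ≤ Rt`. [folklore] -/
theorem ψ_le_Rt : ψ X hqt p hT M ≤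
    Frad (gapc κ X hqt w p hT δA M q) (fun _ => 0) (E₀c κ X hqt w p hT δA M q) 1 - L'c κ X hqt w p hT δA M q :=
  (ψ_le_E₀ (κ := κ)).trans E₀_le_Rt

/-- `ψ (6 t) ≤ Rt` (the first-hop prism fits in the root tube). [folklore] -/
theorem ψ_top_le_Rt : ψ X hqt p hT (6 * tc κ X hqt p hT δA M) ≤
    Frad (gapc κ X hqt w p hT δA M q) (fun _ => 0) (E₀c κ X hqt w p hT δA M q) 1 - L'c κ X hqt w p hT δA M q :=
  (ψ_top_le_E₀ (κ := κ)).trans E₀_le_Rt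

/-- `ψ (t + R') + ψ M ≤ L'` (the root run's `hLψ`). [folklore] -/
theorem hL_root : ψ X hqt p hT (tc κ X hqt p hT δA M + R'c κ X hqt p hT δA M) + ψ X hqt p hT M ≤ L'c κ X hqt w p hT δA M q :=
  (Nat.add_le_add_right (ψ_mid_le (κ := κ)) _).trans hL_reach

/-- `E (g) + 1`-entrances: `Rex q (E g + 1) ≤ (E (g+1) - L') - L'` (the rim excess fits at every depth). [folklore] -/
theorem Rex_le_Erad_sub (g : ℕ) :
    Rexc κ X hqt w p hT δA M q (Erad (gapc κ X hqt w p hT δA M q) (fun _ => 0) (E₀c κ X hqt w p hT δA M q) g + 1) ≤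
      Erad (gapc κ X hqt w p hT δA M q) (fun _ => 0) (E₀c κ X hqt w p hT δA M q) (g + 1) - L'c κ X hqt w p hT δA M q -
        L'c κ X hqt w p hT δA M q := by
  have h := Erad_succ_gapFn_eq (L'c κ X hqt w p hT δA M q) (Rexc κ X hqt w p hT δA M q) (E₀c κ X hqt w p hT δA M q) g
  unfold gapc; rw [h]; omega

variable {hδA : 0 < δA} {msel : W → ℕ} (hat : (choiceAt κ X hqt w p hT hδA).AtQ msel M q)
include hat

/-- **`hlink` at the root's route scales `ℓ ∈ [M+1, t + R']`** at any accuracy `a ≥ δmin`. [folklore] -/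
theorem hlink_root_at {a : ℝ} (ha : δmin κ nR δA ≤ a) : ∀ ℓ, M + 1 ≤ ℓ → ℓ ≤ tc κ X hqt p hT δA M + R'c κ X hqt p hT δA M →
    ∀ τ ∈ reps X hqt, ∀ g : HOct 2, 1 - a ^ 2 < (bondPercolation (X □ zdGraph 2) q).real (linkIn (↑(ufatSeq X hT (reps X hqt) τ ℓ))
      (ufatSeq X hT (reps X hqt) τ (msel τ)) (ballFin X τ (ufatRadius X hT (reps X hqt) ℓ) ×ˢ piece g ℓ)) :=
  fun ℓ h₁ h₂ => hlink_at hat ha ℓ h₁ (h₂.trans tc_add_R'c_le)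

/-- **`hlink` at the first-hop scale `6 t`** at any accuracy `a ≥ δmin` (root and inner first hops). [folklore] -/
theorem hlink_top_at {a : ℝ} (ha : δmin κ nR δA ≤ a) : ∀ τ ∈ reps X hqt, ∀ g : HOct 2,
    1 - a ^ 2 < (bondPercolation (X □ zdGraph 2) q).real (linkIn (↑(ufatSeq X hT (reps X hqt) τ (6 * tc κ X hqt p hT δA M)))
      (ufatSeq X hT (reps X hqt) τ (msel τ)) (ballFin X τ (ufatRadius X hT (reps X hqt) (6 * tc κ X hqt p hT δA M)) ×ˢ
        piece g (6 * tc κ X hqt p hT δA M))) :=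
  hlink_at₁ hat ha le_six_tc le_rfl

end Root

end Conc

end BoxProdZ2

end Transplant

end Summit.CriticalPhenomena.PercolationContinuityZ3.Theorems

end
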